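import Literature.MathematicalPhysics.QuantumFieldTheory.Chatterjee2019LargeN.CoeffCatalanBound
import HarnessLib

/-!
# Uniqueness for the SYMMETRIZED limiting master loop equation of `SO(N)` lattice gauge theory (gauge-boot, ADDENDUM 28 part U)

HONEST FRAMING (cell `pub-gaugeboot`, page 1 of every file): the venture produces certified bounds
on lattice expectations at stated coupling, gauge group, dimension and torus size; NOT a mass gap,
NOT a continuum limit, NOT a string tension; NOT Yang–Mills-summit-bearing (barriers
`FixedCouplingUltralocality`, `PerturbativeInvisibility`).  This file is an elementary analytic lemma about the
strong-coupling LARGE-`N` loop calculus of S. Chatterjee, *Rigorous solution of strongly coupled `SO(N)` lattice gauge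
theory in the large `N` limit*, Comm. Math. Phys. **366** (2019) 203–268; it says nothing about four-dimensional continuum
Yang–Mills or a mass gap.

## Content

The SYMMETRIZED limiting master loop equation (the display of the source's Theorem 9.9 / of the tree's named fact
`SymmetrizedLimitMasterLoopEquation`): for a genuine non-null loop sequence `s`,

  `|s| φ(s) = Σ_{s' ∈ 𝕊⁻(s)} φ(s') − Σ_{s' ∈ 𝕊⁺(s)} φ(s') + β Σ_{s' ∈ 𝔻⁻(s)} φ(s') − β Σ_{s' ∈ 𝔻⁺(s)} φ(s')`.

★ `symmetrized_unique`: for `M ≥ 0`, `L ≥ 1` there is `β₀(M, L, d) > 0` (here `β₀ = (4096 (d+1) (L²+4)⁴)⁻¹`) such that for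
`|β| ≤ β₀` any two functions `φ, ψ` on loop sequences which agree at `∅`, are bounded by `M·L^{|s|}` on genuine loop
sequences, and satisfy the symmetrized equation at `β`, agree on every genuine loop sequence.

The source proves uniqueness only for the MARKED equation (Theorem 9.2, by the `ℓ¹`-functional `F(λ) = Σ_δ λ^{ι(δ)} D(δ)`
over degree vectors; tree `masterLoopSolution_unique`).  The proof here is a weighted sup-norm contraction with the
Catalan weight of the source's Lemma 10.1, `Φ(s) = K^{ι(s)} C_{|l₁|−1} ⋯ C_{|lₙ|−1}`: the positive operator
`𝓛f(s) = |s|⁻¹ (Σ_{splittings} f(s') + |β| Σ_{deformations} f(s'))` satisfies `𝓛Φ ≤ (2/K + 1024(d−1)K⁴|β|) Φ =: θΦ`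
(`operator_weight_le`; per component the second location is reindexed by the cyclic gap and the Catalan recursion
`Σ_g C_{n−g−1}C_{g−1} = C_{n−1}` closes the splitting sums, exactly as in the tree's `CoeffCatalanBoundProof.absCoeff_le_pow`;
a deformation costs `K⁴·4⁴`), while `δ = |φ − ψ| ≤ 2M Φ` (for `K ≥ L²`, since `2ι(s) ≥ |s|`) and `δ ≤ 𝓛δ`; hence
`δ ≤ 2M θⁿ Φ` for every `n`, and `θ ≤ 3/4`.  This lemma is the key to the lane's proof of the source's MAIN THEOREM 3.1
(sibling `GaugeStringDuality`): the 't Hooft limit and the string-trajectory sum both solve the symmetrized equation.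

Everything is `[folklore]` (positive strict supersolution ⇒ uniqueness) given the source's Catalan bookkeeping.
-/

noncomputable section

open Finset Filter Topology
open Literature.MathematicalPhysics.QuantumFieldTheory.Chatterjee2019LargeN
open Literature.MathematicalPhysics.QuantumFieldTheory.Chatterjee2019LargeN.CoeffCatalanBoundProof

namespace Summit.QuantumFields.GaugeBoot

namespace StringDuality

variable {d : ℕ}

/-! ## The Catalan weight `Φ(s) = K^{ι(s)} Π(s)` under the four kinds of moves -/

/-- Positive splittings: `Σ_{o ∈ 𝕊⁺(s)} Φ(s') ≤ |s| K^{ι(s)−1} Π(s)` (gap reindexing + Catalan recursion, `ι(s') < ι(s)`).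
[cite: Chatterjee2019LargeN, proof of Lemma 10.1 (bound (cc2))] -/
theorem sum_sameIdx_weight_le {K : ℝ} (hK : 1 ≤ K) {s : LoopSeq d} (hs : IsLoopSeq s) :
    ∑ o : SameIdx s, K ^ (s.posSplitAt o).index * catProd (s.posSplitAt o) ≤
      (s.len : ℝ) * (K ^ (s.index - 1) * catProd s) := by
  have hK0 : 0 ≤ K := zero_le_one.trans hK
  have hsne : ∀ l ∈ s, l ≠ [] := fun l hl => (hs l hl).2
  set E : ℝ := K ^ (s.index - 1) * catProd s with hE
  refine (sum_sameIdx_le _ (fun i g => K ^ (s.index - 1) *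
    (catProd (s.take i) * ((catalan ((s.get i).length - g - 1) * catalan (g - 1) : ℕ) : ℝ) *
      catProd (s.drop (i + 1)))) (fun i g => ?_) (fun o => ?_)).trans ?_
  · exact mul_nonneg (pow_nonneg hK0 _)
      (mul_nonneg (mul_nonneg (catProd_nonneg _) (Nat.cast_nonneg _)) (catProd_nonneg _))
  · have hlt : (s.posSplitAt o).index < s.index := LoopSeq.index_posSplitAt_lt hsne o
    exact mul_le_mul (pow_le_pow_right₀ hK (by omega)) (catProd_posSplitAt_le hsne o) (catProd_nonneg _)
      (pow_nonneg hK0 _)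
  · rw [← sum_length_get, Finset.sum_mul]
    refine Finset.sum_le_sum fun i _ => ?_
    refine mul_le_mul_of_nonneg_left ?_ (Nat.cast_nonneg _)
    rw [← Finset.mul_sum, hE]
    exact mul_le_mul_of_nonneg_left (sum_Ico_catProd_le s i) (pow_nonneg hK0 _)

/-- Negative splittings: `Σ_{o ∈ 𝕊⁻(s)} Φ(s') ≤ |s| K^{ι(s)−1} Π(s)`. [cite: Chatterjee2019LargeN, proof of Lemma 10.1 (bound (cc1))] -/
theorem sum_invIdx_weight_le {K : ℝ} (hK : 1 ≤ K) {s : LoopSeq d} (hs : IsLoopSeq s) :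
    ∑ o : InvIdx s, K ^ (s.negSplitAt o).index * catProd (s.negSplitAt o) ≤
      (s.len : ℝ) * (K ^ (s.index - 1) * catProd s) := by
  have hK0 : 0 ≤ K := zero_le_one.trans hK
  have hsne : ∀ l ∈ s, l ≠ [] := fun l hl => (hs l hl).2
  set E : ℝ := K ^ (s.index - 1) * catProd s with hE
  refine (sum_invIdx_le _ (fun i g => K ^ (s.index - 1) *
    (catProd (s.take i) * ((catalan ((s.get i).length - g - 1) * catalan (g - 1) : ℕ) : ℝ) *
      catProd (s.drop (i + 1)))) (fun i g => ?_) (fun o => ?_)).trans ?_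
  · exact mul_nonneg (pow_nonneg hK0 _)
      (mul_nonneg (mul_nonneg (catProd_nonneg _) (Nat.cast_nonneg _)) (catProd_nonneg _))
  · have hlt : (s.negSplitAt o).index < s.index := LoopSeq.index_negSplitAt_lt hsne o
    exact mul_le_mul (pow_le_pow_right₀ hK (by omega)) (catProd_negSplitAt_le hsne o) (catProd_nonneg _)
      (pow_nonneg hK0 _)
  · rw [← sum_length_get, Finset.sum_mul]
    refine Finset.sum_le_sum fun i _ => ?_
    refine mul_le_mul_of_nonneg_left ?_ (Nat.cast_nonneg _)
    rw [← Finset.mul_sum, hE]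
    exact mul_le_mul_of_nonneg_left (sum_Ico_catProd_le s i) (pow_nonneg hK0 _)

/-- Deformations (either sign, as a one-word replacement of length `≤ |lᵢ| + 4`): `Σ_{o ∈ 𝔻(s)} Φ(s') ≤ |s|·2(d−1)·256·K^{ι(s)+4} Π(s)`.
[cite: Chatterjee2019LargeN, proof of Lemma 10.1 (bound (cc3), via Lemma 9.6 and (catalan2))] -/
theorem sum_deformIdx_weight_le {K : ℝ} (hK : 1 ≤ K) {s : LoopSeq d} (hs : IsLoopSeq s)
    (op : DeformIdx s → LoopSeq d)
    (hw : ∀ o : DeformIdx s, ∃ w : List (DEdge d), w.length ≤ (s.get o.1).length + 4 ∧ op o = s.replaceAt o.1 [w]) :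
    ∑ o : DeformIdx s, K ^ (op o).index * catProd (op o) ≤
      (s.len : ℝ) * (((2 * (d - 1) : ℕ) : ℝ) * (256 * (K ^ (s.index + 4) * catProd s))) := by
  have hK0 : 0 ≤ K := zero_le_one.trans hK
  have hsne : ∀ l ∈ s, l ≠ [] := fun l hl => (hs l hl).2
  set E : ℝ := K ^ (s.index + 4) * catProd s with hE
  have hE0 : 0 ≤ E := mul_nonneg (pow_nonneg hK0 _) (catProd_nonneg s)
  refine (sum_deformIdx_le _ (fun _ => 256 * E) (fun _ => mul_nonneg (by norm_num) hE0) (fun o => ?_)).trans ?_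
  · obtain ⟨w, hwl, hwe⟩ := hw o
    have hidx : (op o).index ≤ s.index + 4 := by rw [hwe]; exact index_replaceAt_one_le_four hsne o.1 w hwl
    have hcat : catProd (op o) ≤ 256 * catProd s := by rw [hwe]; exact catProd_replaceAt_one_le hsne o.1 w hwl
    calc K ^ (op o).index * catProd (op o) ≤ K ^ (s.index + 4) * (256 * catProd s) :=
          mul_le_mul (pow_le_pow_right₀ hK hidx) hcat (catProd_nonneg _) (pow_nonneg hK0 _)
      _ = 256 * E := by rw [hE]; ring
  · rw [← sum_length_get, Finset.sum_mul]
    exact le_of_eq (Finset.sum_congr rfl fun i _ => by ring)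

/-- **The Catalan weight is a strict supersolution**: for a genuine non-null `s` and `K ≥ 1`,
`Σ_{𝕊⁻} Φ + Σ_{𝕊⁺} Φ + |β| (Σ_{𝔻⁻} Φ + Σ_{𝔻⁺} Φ) ≤ |s| · (2/K + |β|·2·2(d−1)·256·K⁴) · Φ(s)`.
[cite: Chatterjee2019LargeN, proof of Lemma 10.1 (the bracket 4K⁻³ + 4K⁻¹ + 1024 d K⁻¹)] -/
theorem operator_weight_le {K : ℝ} (hK : 1 ≤ K) (β : ℝ) {s : LoopSeq d} (hs : IsLoopSeq s) (hne : s ≠ []) :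
    ((∑ o : InvIdx s, K ^ (s.negSplitAt o).index * catProd (s.negSplitAt o))
        + ∑ o : SameIdx s, K ^ (s.posSplitAt o).index * catProd (s.posSplitAt o))
      + |β| * ((∑ o : DeformIdx s, K ^ (s.negDeformAt o).index * catProd (s.negDeformAt o))
        + ∑ o : DeformIdx s, K ^ (s.posDeformAt o).index * catProd (s.posDeformAt o)) ≤
      (s.len : ℝ) * ((2 / K + |β| * (2 * ((2 * (d - 1) : ℕ) : ℝ) * 256 * K ^ 4)) * (K ^ s.index * catProd s)) := by
  have hK0 : 0 < K := lt_of_lt_of_le one_pos hK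
  have h1 := sum_invIdx_weight_le hK hs
  have h2 := sum_sameIdx_weight_le hK hs
  have h3 := sum_deformIdx_weight_le hK hs (fun o => s.negDeformAt o)
    (fun o => ⟨_, Word.length_negDeform_le (s.get o.1) o.2.1 o.2.2.1, rfl⟩)
  have h4 := sum_deformIdx_weight_le hK hs (fun o => s.posDeformAt o)
    (fun o => ⟨_, Word.length_posDeform_le (s.get o.1) o.2.1 o.2.2.1, rfl⟩)
  obtain ⟨j, hj⟩ : ∃ j : ℕ, s.index = j + 1 := ⟨s.index - 1, (Nat.sub_add_cancel (one_le_index hs hne)).symm⟩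
  rw [hj] at h1 h2 h3 h4 ⊢
  simp only [Nat.add_sub_cancel] at h1 h2
  have hrhs : (s.len : ℝ) * ((2 / K + |β| * (2 * ((2 * (d - 1) : ℕ) : ℝ) * 256 * K ^ 4)) * (K ^ (j + 1) * catProd s)) =
      ((s.len : ℝ) * (K ^ j * catProd s) + (s.len : ℝ) * (K ^ j * catProd s))
        + |β| * ((s.len : ℝ) * (((2 * (d - 1) : ℕ) : ℝ) * (256 * (K ^ (j + 1 + 4) * catProd s)))
          + (s.len : ℝ) * (((2 * (d - 1) : ℕ) : ℝ) * (256 * (K ^ (j + 1 + 4) * catProd s)))) := by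
    field_simp
    ring
  rw [hrhs]
  exact add_le_add (add_le_add h1 h2) (mul_le_mul_of_nonneg_left (add_le_add h3 h4) (abs_nonneg β))

/-- For a genuine loop sequence, `L^{|s|} ≤ K^{ι(s)} Π(s)` as soon as `L² ≤ K` (`2ι(s) ≥ |s|`, `Π ≥ 1`).
[cite: Chatterjee2019LargeN, Lemma 9.7 (|s| ≥ 4#s, hence ι(s) ≥ |s|/2)] -/
theorem pow_len_le_weight {K L : ℝ} (hL : 1 ≤ L) (hLK : L ^ 2 ≤ K) {s : LoopSeq d} (hs : IsLoopSeq s) :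
    L ^ s.len ≤ K ^ s.index * catProd s := by
  have hlen : s.len ≤ 2 * s.index := by
    have := two_mul_size_le_len hs
    unfold LoopSeq.index
    omega
  have hK0 : 0 ≤ K := (sq_nonneg L).trans hLK
  calc L ^ s.len ≤ L ^ (2 * s.index) := pow_le_pow_right₀ hL hlen
    _ = (L ^ 2) ^ s.index := by rw [pow_mul]
    _ ≤ K ^ s.index := pow_le_pow_left₀ (sq_nonneg L) hLK _
    _ ≤ K ^ s.index * catProd s := le_mul_of_one_le_right (pow_nonneg hK0 _) (one_le_catProd s)

/-! ## The uniqueness theorem -/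

/-- ★ **Uniqueness for the symmetrized limiting master loop equation.**  For `M ≥ 0`, `L ≥ 1` put
`β₀ = (4096 (d+1) (L²+4)⁴)⁻¹`.  If `|β| ≤ β₀` and `φ, ψ : 𝒮 → ℝ` agree at `∅`, satisfy `|φ(s)|, |ψ(s)| ≤ M L^{|s|}` on genuine
loop sequences and both satisfy
`|s| f(s) = Σ_{𝕊⁻(s)} f − Σ_{𝕊⁺(s)} f + β Σ_{𝔻⁻(s)} f − β Σ_{𝔻⁺(s)} f` for every genuine non-null `s` (the display of the
source's Theorem 9.9), then `φ = ψ` on genuine loop sequences.  Proof: weighted sup-norm contraction with the Catalan weight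
`K^{ι(s)} Π(s)`, `K = L² + 4` (`operator_weight_le`, `pow_len_le_weight`).
[cite: Chatterjee2019LargeN, Theorem 9.2 (uniqueness, marked form) and Theorem 9.9 (the symmetrized equation); Lemma 10.1 (the Catalan weight)] -/
theorem symmetrized_unique {M L : ℝ} (hM : 0 ≤ M) (hL : 1 ≤ L) :
    ∃ β₀ : ℝ, 0 < β₀ ∧ ∀ β : ℝ, |β| ≤ β₀ → ∀ φ ψ : LoopSeq d → ℝ, φ [] = ψ [] →
      (∀ s : LoopSeq d, IsLoopSeq s → |φ s| ≤ M * L ^ s.len) →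
      (∀ s : LoopSeq d, IsLoopSeq s → |ψ s| ≤ M * L ^ s.len) →
      (∀ s : LoopSeq d, IsLoopSeq s → s ≠ [] →
          (s.len : ℝ) * φ s =
            (∑ o : InvIdx s, φ (s.negSplitAt o)) - (∑ o : SameIdx s, φ (s.posSplitAt o))
              + β * (∑ o : DeformIdx s, φ (s.negDeformAt o))
              - β * (∑ o : DeformIdx s, φ (s.posDeformAt o))) →
      (∀ s : LoopSeq d, IsLoopSeq s → s ≠ [] →
          (s.len : ℝ) * ψ s =
            (∑ o : InvIdx s, ψ (s.negSplitAt o)) - (∑ o : SameIdx s, ψ (s.posSplitAt o))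
              + β * (∑ o : DeformIdx s, ψ (s.negDeformAt o))
              - β * (∑ o : DeformIdx s, ψ (s.posDeformAt o))) →
      ∀ s : LoopSeq d, IsLoopSeq s → φ s = ψ s := by
  set K : ℝ := L ^ 2 + 4 with hKdef
  have hL2 : 0 ≤ L ^ 2 := sq_nonneg L
  have hK4 : 4 ≤ K := by rw [hKdef]; linarith
  have hK1 : 1 ≤ K := by linarith
  have hK0 : 0 < K := by linarith
  have hLK : L ^ 2 ≤ K := by rw [hKdef]; linarith
  set P : ℝ := ((2 * (d - 1) : ℕ) : ℝ) with hPdef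
  have hP0 : 0 ≤ P := Nat.cast_nonneg _
  have hP : P ≤ 2 * ((d : ℝ) + 1) := by
    have h : (2 * (d - 1) : ℕ) ≤ 2 * (d + 1) := by omega
    rw [hPdef]
    exact_mod_cast h
  refine ⟨1 / (4096 * ((d : ℝ) + 1) * K ^ 4), by positivity, fun β hβ φ ψ h0 hφb hψb hφe hψe => ?_⟩
  -- the contraction constant
  set θ : ℝ := 2 / K + |β| * (2 * P * 256 * K ^ 4) with hθdef
  have hθ0 : 0 ≤ θ := by positivity
  have hθ1 : θ < 1 := by
    have h1 : 2 / K ≤ 1 / 2 := by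
      rw [div_le_iff₀ hK0]
      linarith
    have h2 : |β| * (2 * P * 256 * K ^ 4) ≤ 1 / 4 := by
      calc |β| * (2 * P * 256 * K ^ 4)
          ≤ (1 / (4096 * ((d : ℝ) + 1) * K ^ 4)) * (2 * (2 * ((d : ℝ) + 1)) * 256 * K ^ 4) := by
            apply mul_le_mul hβ _ (by positivity) (by positivity)
            gcongr
        _ = 1 / 4 := by
            field_simp
            ring
    linarith
  -- initial bound: `|φ − ψ| ≤ 2M Φ`
  have hinit : ∀ s : LoopSeq d, IsLoopSeq s → |φ s - ψ s| ≤ 2 * M * (K ^ s.index * catProd s) := by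
    intro s hs
    calc |φ s - ψ s| ≤ |φ s| + |ψ s| := abs_sub _ _
      _ ≤ M * L ^ s.len + M * L ^ s.len := add_le_add (hφb s hs) (hψb s hs)
      _ = 2 * M * L ^ s.len := by ring
      _ ≤ 2 * M * (K ^ s.index * catProd s) :=
          mul_le_mul_of_nonneg_left (pow_len_le_weight hL hLK hs) (by positivity)
  -- iteration: `|φ − ψ| ≤ 2M θⁿ Φ`
  have hiter : ∀ n : ℕ, ∀ s : LoopSeq d, IsLoopSeq s →
      |φ s - ψ s| ≤ 2 * M * θ ^ n * (K ^ s.index * catProd s) := by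
    intro n
    induction n with
    | zero =>
      intro s hs
      simpa only [pow_zero, mul_one] using hinit s hs
    | succ n ih =>
      intro s hs
      by_cases hne : s = []
      · subst hne
        rw [h0, sub_self, abs_zero]
        exact mul_nonneg (by positivity) (mul_nonneg (pow_nonneg hK0.le _) (catProd_nonneg _))
      have hlen : (0 : ℝ) < s.len := by
        have h1 := two_mul_size_le_len hs
        have h2 : 1 ≤ s.size := List.length_pos_of_ne_nil hne
        have h3 : 1 ≤ s.len := by omega
        exact_mod_cast h3
      set c : ℝ := 2 * M * θ ^ n with hc
      have hc0 : 0 ≤ c := by positivity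
      -- the four weighted sums of the results
      set S₁ : ℝ := ∑ o : InvIdx s, K ^ (s.negSplitAt o).index * catProd (s.negSplitAt o) with hS₁
      set S₂ : ℝ := ∑ o : SameIdx s, K ^ (s.posSplitAt o).index * catProd (s.posSplitAt o) with hS₂
      set S₃ : ℝ := ∑ o : DeformIdx s, K ^ (s.negDeformAt o).index * catProd (s.negDeformAt o) with hS₃
      set S₄ : ℝ := ∑ o : DeformIdx s, K ^ (s.posDeformAt o).index * catProd (s.posDeformAt o) with hS₄
      have e1 : |∑ o : InvIdx s, (φ (s.negSplitAt o) - ψ (s.negSplitAt o))| ≤ c * S₁ := by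
        refine (Finset.abs_sum_le_sum_abs _ _).trans ?_
        rw [hS₁, Finset.mul_sum]
        exact Finset.sum_le_sum fun o _ => ih _ (hs.negSplitAt o)
      have e2 : |∑ o : SameIdx s, (φ (s.posSplitAt o) - ψ (s.posSplitAt o))| ≤ c * S₂ := by
        refine (Finset.abs_sum_le_sum_abs _ _).trans ?_
        rw [hS₂, Finset.mul_sum]
        exact Finset.sum_le_sum fun o _ => ih _ (hs.posSplitAt o)
      have e3 : |∑ o : DeformIdx s, (φ (s.negDeformAt o) - ψ (s.negDeformAt o))| ≤ c * S₃ := by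
        refine (Finset.abs_sum_le_sum_abs _ _).trans ?_
        rw [hS₃, Finset.mul_sum]
        exact Finset.sum_le_sum fun o _ => ih _ (hs.negDeformAt o)
      have e4 : |∑ o : DeformIdx s, (φ (s.posDeformAt o) - ψ (s.posDeformAt o))| ≤ c * S₄ := by
        refine (Finset.abs_sum_le_sum_abs _ _).trans ?_
        rw [hS₄, Finset.mul_sum]
        exact Finset.sum_le_sum fun o _ => ih _ (hs.posDeformAt o)
      -- subtract the two equations
      have hdiff : (s.len : ℝ) * (φ s - ψ s) =
          ((∑ o : InvIdx s, (φ (s.negSplitAt o) - ψ (s.negSplitAt o)))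
            - ∑ o : SameIdx s, (φ (s.posSplitAt o) - ψ (s.posSplitAt o)))
            + β * ((∑ o : DeformIdx s, (φ (s.negDeformAt o) - ψ (s.negDeformAt o)))
              - ∑ o : DeformIdx s, (φ (s.posDeformAt o) - ψ (s.posDeformAt o))) := by
        rw [mul_sub, hφe s hs hne, hψe s hs hne]
        simp only [Finset.sum_sub_distrib]
        ring
      have key : (s.len : ℝ) * |φ s - ψ s| ≤ c * ((S₁ + S₂) + |β| * (S₃ + S₄)) := by
        calc (s.len : ℝ) * |φ s - ψ s| = |(s.len : ℝ) * (φ s - ψ s)| := by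
              rw [abs_mul, abs_of_pos hlen]
          _ = _ := by rw [hdiff]
          _ ≤ |(∑ o : InvIdx s, (φ (s.negSplitAt o) - ψ (s.negSplitAt o)))
                - ∑ o : SameIdx s, (φ (s.posSplitAt o) - ψ (s.posSplitAt o))|
              + |β * ((∑ o : DeformIdx s, (φ (s.negDeformAt o) - ψ (s.negDeformAt o)))
                - ∑ o : DeformIdx s, (φ (s.posDeformAt o) - ψ (s.posDeformAt o)))| := abs_add_le _ _
          _ ≤ (c * S₁ + c * S₂) + |β| * (c * S₃ + c * S₄) := by
              refine add_le_add ((abs_sub _ _).trans (add_le_add e1 e2)) ?_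
              rw [abs_mul]
              exact mul_le_mul_of_nonneg_left ((abs_sub _ _).trans (add_le_add e3 e4)) (abs_nonneg β)
          _ = c * ((S₁ + S₂) + |β| * (S₃ + S₄)) := by ring
      have hop : (S₁ + S₂) + |β| * (S₃ + S₄) ≤ (s.len : ℝ) * (θ * (K ^ s.index * catProd s)) := by
        have h := operator_weight_le hK1 β hs hne
        rw [← hPdef] at h
        exact h
      have hfin : (s.len : ℝ) * |φ s - ψ s| ≤ (s.len : ℝ) * (c * θ * (K ^ s.index * catProd s)) := by
        calc (s.len : ℝ) * |φ s - ψ s| ≤ c * ((S₁ + S₂) + |β| * (S₃ + S₄)) := key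
          _ ≤ c * ((s.len : ℝ) * (θ * (K ^ s.index * catProd s))) := mul_le_mul_of_nonneg_left hop hc0
          _ = (s.len : ℝ) * (c * θ * (K ^ s.index * catProd s)) := by ring
      have := le_of_mul_le_mul_left hfin hlen
      calc |φ s - ψ s| ≤ c * θ * (K ^ s.index * catProd s) := this
        _ = 2 * M * θ ^ (n + 1) * (K ^ s.index * catProd s) := by rw [hc, pow_succ]; ring
  -- conclusion: `θⁿ → 0`
  intro s hs
  have hlim : Tendsto (fun n : ℕ => 2 * M * θ ^ n * (K ^ s.index * catProd s)) atTop (𝓝 0) := by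
    have h := ((tendsto_pow_atTop_nhds_zero_of_lt_one hθ0 hθ1).const_mul (2 * M)).mul_const
      (K ^ s.index * catProd s)
    simpa only [mul_zero, zero_mul] using h
  have habs : |φ s - ψ s| ≤ 0 := ge_of_tendsto' hlim fun n => hiter n s hs
  exact sub_eq_zero.mp (abs_nonpos_iff.mp habs)

end StringDuality

end Summit.QuantumFields.GaugeBoot

end
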